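import Literature.Probability.LatticeModels.CollarLegModel

/-!
# Stub `stub_referenceLimit` of line `rainbow-monomials-in-excursion-kernels` — Part 1:
# the counter-clockwise boundary walk of a lattice box (`CollarLegModel.dsucc`, `outDart`, `period`, `cycle`)

Crux `BoundaryDefectGaussianR` (stmt-CriticalPhenomena-14132). The approximability half of the
reference-limit stub needs `LegInsertionData.IsAdmissible` for rainbow data on the lattice boxes
`V = [x0, x0 + W] × [y0, y0 + H] ∩ ℤ²`; this file computes the boundary walk of such a box
explicitly: the exterior dart of a bottom-row vertex, the successor `dsucc` along each side and at
each (convex) corner, the iterates of `dsucc` from a bottom dart `((x0 + c, y0), S)`, the first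
return time `period = 2W + 2H + 4`, and hence the list `cycle`.

Conventions (from `CollarLegModel`): directions `0 = E, 1 = N, 2 = W, 3 = S`; a dart `(v, k)` is
the edge leaving `v` in direction `k`; the box is given by a membership hypothesis
`hV : ∀ v, v ∈ V ↔ (x0 ≤ v.1 ∧ v.1 ≤ x0 + W) ∧ (y0 ≤ v.2 ∧ v.2 ≤ y0 + H)` (the form in which the
crux hands over its lattice approximations).
-/

namespace Summit.CriticalPhenomena.CardyFormulaZ2.Cruxes.BoundaryDefectGaussianR.RainbowMonomialsInExcursionKernels

open Literature.Probability.LatticeModels Literature.Probability.LatticeModels.CollarLegModel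

/-! ### The four directions -/

/-- `dir 0 = E`. [folklore] -/
@[simp] theorem dir_zero : dir 0 = (1, 0) := by decide
/-- `dir 1 = N`. [folklore] -/
@[simp] theorem dir_one : dir 1 = (0, 1) := by decide
/-- `dir 2 = W`. [folklore] -/
@[simp] theorem dir_two : dir 2 = (-1, 0) := by decide
/-- `dir 3 = S`. [folklore] -/
@[simp] theorem dir_three : dir 3 = (0, -1) := by decide

/-- `List.finRange 4` spelled out. [folklore] -/
theorem finRange_four : List.finRange 4 = [0, 1, 2, 3] := by decide

section Box

variable {V : Finset (ℤ × ℤ)} {x0 y0 : ℤ} {W H : ℕ}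
  (hV : ∀ v : ℤ × ℤ, v ∈ V ↔ (x0 ≤ v.1 ∧ v.1 ≤ x0 + W) ∧ (y0 ≤ v.2 ∧ v.2 ≤ y0 + H))
include hV

/-! ### `dsucc` on a box: straight along the four sides, turning at the four corners -/

/-- Bottom side, going east: the `S`-dart of `(m, y0)` with `m < x0 + W` is followed by the
`S`-dart of `(m + 1, y0)`. [folklore] -/
theorem dsucc_bottom {m : ℤ} (hm0 : x0 ≤ m + 1) (hm : m < x0 + W) :
    dsucc V ((m, y0), 3) = ((m + 1, y0), 3) := by
  have e4 : (3 : Fin 4) + 1 = 0 := by decide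
  have h1 : ((m, y0) : ℤ × ℤ) + dir (3 + 1) ∈ V := by
    rw [e4, dir_zero, hV]; simp; omega
  have h2 : ((m, y0) : ℤ × ℤ) + dir (3 + 1) + dir 3 ∉ V := by
    rw [e4, dir_zero, dir_three, hV]; simp
  rw [dsucc, if_neg (not_not.mpr h1), if_pos h2]
  simp

/-- Bottom-right corner: the `S`-dart of `(x0 + W, y0)` is followed by its `E`-dart. [folklore] -/
theorem dsucc_corner_br :
    dsucc V ((x0 + W, y0), 3) = ((x0 + W, y0), 0) := by
  have e4 : (3 : Fin 4) + 1 = 0 := by decide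
  have h1 : ((x0 + W, y0) : ℤ × ℤ) + dir (3 + 1) ∉ V := by
    rw [e4, dir_zero, hV]; simp
  rw [dsucc, if_pos h1]
  simp

/-- Right side, going north: the `E`-dart of `(x0 + W, y)` with `y < y0 + H` is followed by the
`E`-dart of `(x0 + W, y + 1)`. [folklore] -/
theorem dsucc_right {y : ℤ} (hy0 : y0 ≤ y + 1) (hy : y < y0 + H) :
    dsucc V ((x0 + W, y), 0) = ((x0 + W, y + 1), 0) := by
  have e4 : (0 : Fin 4) + 1 = 1 := by decide
  have h1 : ((x0 + W, y) : ℤ × ℤ) + dir (0 + 1) ∈ V := by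
    rw [e4, dir_one, hV]; simp; omega
  have h2 : ((x0 + W, y) : ℤ × ℤ) + dir (0 + 1) + dir 0 ∉ V := by
    rw [e4, dir_one, dir_zero, hV]; simp
  rw [dsucc, if_neg (not_not.mpr h1), if_pos h2]
  simp

/-- Top-right corner: the `E`-dart of `(x0 + W, y0 + H)` is followed by its `N`-dart. [folklore] -/
theorem dsucc_corner_tr :
    dsucc V ((x0 + W, y0 + H), 0) = ((x0 + W, y0 + H), 1) := by
  have e4 : (0 : Fin 4) + 1 = 1 := by decide
  have h1 : ((x0 + W, y0 + H) : ℤ × ℤ) + dir (0 + 1) ∉ V := by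
    rw [e4, dir_one, hV]; simp
  rw [dsucc, if_pos h1]
  simp

/-- Top side, going west: the `N`-dart of `(m, y0 + H)` with `x0 < m` is followed by the `N`-dart
of `(m - 1, y0 + H)`. [folklore] -/
theorem dsucc_top {m : ℤ} (hm0 : x0 < m) (hm : m - 1 ≤ x0 + W) :
    dsucc V ((m, y0 + H), 1) = ((m - 1, y0 + H), 1) := by
  have e4 : (1 : Fin 4) + 1 = 2 := by decide
  have h1 : ((m, y0 + H) : ℤ × ℤ) + dir (1 + 1) ∈ V := by
    rw [e4, dir_two, hV]; simp; omega
  have h2 : ((m, y0 + H) : ℤ × ℤ) + dir (1 + 1) + dir 1 ∉ V := by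
    rw [e4, dir_two, dir_one, hV]; simp
  rw [dsucc, if_neg (not_not.mpr h1), if_pos h2]
  simp; ring

/-- Top-left corner: the `N`-dart of `(x0, y0 + H)` is followed by its `W`-dart. [folklore] -/
theorem dsucc_corner_tl :
    dsucc V ((x0, y0 + H), 1) = ((x0, y0 + H), 2) := by
  have e4 : (1 : Fin 4) + 1 = 2 := by decide
  have h1 : ((x0, y0 + H) : ℤ × ℤ) + dir (1 + 1) ∉ V := by
    rw [e4, dir_two, hV]; simp
  rw [dsucc, if_pos h1]
  simp

/-- Left side, going south: the `W`-dart of `(x0, y)` with `y0 < y` is followed by the `W`-dart of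
`(x0, y - 1)`. [folklore] -/
theorem dsucc_left {y : ℤ} (hy0 : y0 < y) (hy : y - 1 ≤ y0 + H) :
    dsucc V ((x0, y), 2) = ((x0, y - 1), 2) := by
  have e4 : (2 : Fin 4) + 1 = 3 := by decide
  have h1 : ((x0, y) : ℤ × ℤ) + dir (2 + 1) ∈ V := by
    rw [e4, dir_three, hV]; simp; omega
  have h2 : ((x0, y) : ℤ × ℤ) + dir (2 + 1) + dir 2 ∉ V := by
    rw [e4, dir_three, dir_two, hV]; simp
  rw [dsucc, if_neg (not_not.mpr h1), if_pos h2]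
  simp; ring

/-- Bottom-left corner: the `W`-dart of `(x0, y0)` is followed by its `S`-dart. [folklore] -/
theorem dsucc_corner_bl :
    dsucc V ((x0, y0), 2) = ((x0, y0), 3) := by
  have e4 : (2 : Fin 4) + 1 = 3 := by decide
  have h1 : ((x0, y0) : ℤ × ℤ) + dir (2 + 1) ∉ V := by
    rw [e4, dir_three, hV]; simp
  rw [dsucc, if_pos h1]
  simp


/-! ### Iterating `dsucc` along the sides -/

/-- Bottom side: `u` steps east from the `S`-dart of `(m, y0)`. [folklore] -/
theorem iterate_dsucc_bottom {m : ℤ} (hm0 : x0 ≤ m) (u : ℕ) (hu : m + u ≤ x0 + W) :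
    (dsucc V)^[u] ((m, y0), 3) = ((m + u, y0), 3) := by
  induction u with
  | zero => simp
  | succ u ih =>
    rw [Function.iterate_succ_apply', ih (by push_cast at hu; omega),
      dsucc_bottom hV (by omega) (by push_cast at hu; omega)]
    push_cast; ring_nf

/-- Right side: `u` steps north from the `E`-dart of `(x0 + W, y)`. [folklore] -/
theorem iterate_dsucc_right {y : ℤ} (hy0 : y0 ≤ y) (u : ℕ) (hu : y + u ≤ y0 + H) :
    (dsucc V)^[u] ((x0 + W, y), 0) = ((x0 + W, y + u), 0) := by
  induction u with
  | zero => simp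
  | succ u ih =>
    rw [Function.iterate_succ_apply', ih (by push_cast at hu; omega),
      dsucc_right hV (by omega) (by push_cast at hu; omega)]
    push_cast; ring_nf

/-- Top side: `u` steps west from the `N`-dart of `(m, y0 + H)`. [folklore] -/
theorem iterate_dsucc_top {m : ℤ} (hm : m ≤ x0 + W) (u : ℕ) (hu : x0 ≤ m - u) :
    (dsucc V)^[u] ((m, y0 + H), 1) = ((m - u, y0 + H), 1) := by
  induction u with
  | zero => simp
  | succ u ih =>
    rw [Function.iterate_succ_apply', ih (by push_cast at hu; omega),
      dsucc_top hV (by push_cast at hu; omega) (by omega)]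
    push_cast; ring_nf

/-- Left side: `u` steps south from the `W`-dart of `(x0, y)`. [folklore] -/
theorem iterate_dsucc_left {y : ℤ} (hy : y ≤ y0 + H) (u : ℕ) (hu : y0 ≤ y - u) :
    (dsucc V)^[u] ((x0, y), 2) = ((x0, y - u), 2) := by
  induction u with
  | zero => simp
  | succ u ih =>
    rw [Function.iterate_succ_apply', ih (by push_cast at hu; omega),
      dsucc_left hV (by push_cast at hu; omega) (by omega)]
    push_cast; ring_nf

/-! ### The full tour from a bottom dart `((x0 + c, y0), S)` -/

/-- Phase A (rest of the bottom side): for `u ≤ W - c`, the `u`-th dart is the `S`-dart of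
`(x0 + c + u, y0)`. [folklore] -/
theorem tour_bottom {c : ℕ} (hc : c ≤ W) (u : ℕ) (hu : u ≤ W - c) :
    (dsucc V)^[u] ((x0 + c, y0), 3) = ((x0 + c + u, y0), 3) :=
  iterate_dsucc_bottom hV (by omega) u (by omega)

/-- The bottom-right corner is reached after `W - c` steps and turned at step `W - c + 1`. [folklore] -/
theorem tour_corner_br {c : ℕ} (hc : c ≤ W) :
    (dsucc V)^[W - c + 1] ((x0 + c, y0), 3) = ((x0 + W, y0), 0) := by
  rw [Function.iterate_succ_apply', tour_bottom hV hc (W - c) le_rfl]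
  have : (x0 + c + ((W - c : ℕ) : ℤ)) = x0 + W := by push_cast [Nat.cast_sub hc]; ring
  rw [this, dsucc_corner_br hV]

/-- Phase B (right side): for `u ≤ H`, dart `W - c + 1 + u` is the `E`-dart of `(x0 + W, y0 + u)`. [folklore] -/
theorem tour_right {c : ℕ} (hc : c ≤ W) (u : ℕ) (hu : u ≤ H) :
    (dsucc V)^[W - c + 1 + u] ((x0 + c, y0), 3) = ((x0 + W, y0 + u), 0) := by
  rw [Nat.add_comm, Function.iterate_add_apply, tour_corner_br hV hc,
    iterate_dsucc_right hV le_rfl u (by omega)]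

/-- The top-right corner is turned at step `W - c + H + 2`. [folklore] -/
theorem tour_corner_tr {c : ℕ} (hc : c ≤ W) :
    (dsucc V)^[W - c + H + 2] ((x0 + c, y0), 3) = ((x0 + W, y0 + H), 1) := by
  rw [show W - c + H + 2 = (W - c + 1 + H) + 1 by omega, Function.iterate_succ_apply',
    tour_right hV hc H le_rfl, dsucc_corner_tr hV]

/-- Phase C (top side): for `u ≤ W`, dart `W - c + H + 2 + u` is the `N`-dart of `(x0 + W - u, y0 + H)`. [folklore] -/
theorem tour_top {c : ℕ} (hc : c ≤ W) (u : ℕ) (hu : u ≤ W) :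
    (dsucc V)^[W - c + H + 2 + u] ((x0 + c, y0), 3) = ((x0 + W - u, y0 + H), 1) := by
  rw [Nat.add_comm, Function.iterate_add_apply, tour_corner_tr hV hc,
    iterate_dsucc_top hV le_rfl u (by omega)]

/-- The top-left corner is turned at step `W - c + H + W + 3`. [folklore] -/
theorem tour_corner_tl {c : ℕ} (hc : c ≤ W) :
    (dsucc V)^[W - c + H + W + 3] ((x0 + c, y0), 3) = ((x0, y0 + H), 2) := by
  rw [show W - c + H + W + 3 = (W - c + H + 2 + W) + 1 by omega, Function.iterate_succ_apply',
    tour_top hV hc W le_rfl, show x0 + (W : ℤ) - (W : ℤ) = x0 by ring, dsucc_corner_tl hV]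

/-- Phase D (left side): for `u ≤ H`, dart `W - c + H + W + 3 + u` is the `W`-dart of `(x0, y0 + H - u)`. [folklore] -/
theorem tour_left {c : ℕ} (hc : c ≤ W) (u : ℕ) (hu : u ≤ H) :
    (dsucc V)^[W - c + H + W + 3 + u] ((x0 + c, y0), 3) = ((x0, y0 + H - u), 2) := by
  rw [Nat.add_comm, Function.iterate_add_apply, tour_corner_tl hV hc,
    iterate_dsucc_left hV le_rfl u (by omega)]

/-- The bottom-left corner is turned at step `W - c + 2H + W + 4`. [folklore] -/
theorem tour_corner_bl {c : ℕ} (hc : c ≤ W) :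
    (dsucc V)^[W - c + H + W + H + 4] ((x0 + c, y0), 3) = ((x0, y0), 3) := by
  rw [show W - c + H + W + H + 4 = (W - c + H + W + 3 + H) + 1 by omega, Function.iterate_succ_apply',
    tour_left hV hc H le_rfl, show y0 + (H : ℤ) - (H : ℤ) = y0 by ring, dsucc_corner_bl hV]

/-- Phase E (start of the bottom side): for `u ≤ c`, dart `W - c + 2H + W + 4 + u` is the `S`-dart
of `(x0 + u, y0)`. [folklore] -/
theorem tour_bottom' {c : ℕ} (hc : c ≤ W) (u : ℕ) (hu : u ≤ c) :
    (dsucc V)^[W - c + H + W + H + 4 + u] ((x0 + c, y0), 3) = ((x0 + u, y0), 3) := by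
  rw [Nat.add_comm, Function.iterate_add_apply, tour_corner_bl hV hc,
    iterate_dsucc_bottom hV le_rfl u (by omega)]

/-- **The walk closes up after `2W + 2H + 4` steps.** [folklore] -/
theorem tour_period {c : ℕ} (hc : c ≤ W) :
    (dsucc V)^[2 * W + 2 * H + 4] ((x0 + c, y0), 3) = ((x0 + c, y0), 3) := by
  rw [show 2 * W + 2 * H + 4 = W - c + H + W + H + 4 + c by omega, tour_bottom' hV hc c le_rfl]

/-- **No earlier return**: for `0 < n < 2W + 2H + 4` the `n`-th dart differs from the start. [folklore] -/
theorem tour_ne {c : ℕ} (hc : c ≤ W) {n : ℕ} (hn0 : 0 < n) (hn : n < 2 * W + 2 * H + 4) :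
    (dsucc V)^[n] ((x0 + c, y0), 3) ≠ ((x0 + c, y0), 3) := by
  intro h
  rcases Nat.lt_or_ge n (W - c + 1) with hA | hA
  · rw [tour_bottom hV hc n (by omega)] at h
    have := congrArg (fun d : Dart => d.1.1) h
    simp at this; omega
  rcases Nat.lt_or_ge n (W - c + H + 2) with hB | hB
  · obtain ⟨u, hu, rfl⟩ : ∃ u, u ≤ H ∧ n = W - c + 1 + u := ⟨n - (W - c + 1), by omega, by omega⟩
    rw [tour_right hV hc u hu] at h
    have := congrArg (fun d : Dart => d.2) h
    simp at this
  rcases Nat.lt_or_ge n (W - c + H + W + 3) with hC | hC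
  · obtain ⟨u, hu, rfl⟩ : ∃ u, u ≤ W ∧ n = W - c + H + 2 + u := ⟨n - (W - c + H + 2), by omega, by omega⟩
    rw [tour_top hV hc u hu] at h
    have := congrArg (fun d : Dart => d.2) h
    simp at this
  rcases Nat.lt_or_ge n (W - c + H + W + H + 4) with hD | hD
  · obtain ⟨u, hu, rfl⟩ : ∃ u, u ≤ H ∧ n = W - c + H + W + 3 + u := ⟨n - (W - c + H + W + 3), by omega, by omega⟩
    rw [tour_left hV hc u hu] at h
    have := congrArg (fun d : Dart => d.2) h
    simp at this
  · obtain ⟨u, hu, rfl⟩ : ∃ u, u < c ∧ n = W - c + H + W + H + 4 + u :=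
      ⟨n - (W - c + H + W + H + 4), by omega, by omega⟩
    rw [tour_bottom' hV hc u hu.le] at h
    have := congrArg (fun d : Dart => d.1.1) h
    simp at this; omega

/-! ### Cardinality, `period` and `cycle` of the box -/

/-- The box is the product of two integer intervals. [folklore] -/
theorem box_eq_product :
    V = Finset.Icc x0 (x0 + W) ×ˢ Finset.Icc y0 (y0 + H) := by
  ext v; rw [hV]; simp

/-- The box has `(W + 1)(H + 1)` vertices. [folklore] -/
theorem card_box :
    V.card = (W + 1) * (H + 1) := by
  rw [box_eq_product hV, Finset.card_product, Int.card_Icc, Int.card_Icc]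
  congr 1 <;> omega

/-- **The period of the boundary walk of the box** through a bottom dart is `2W + 2H + 4`
(each side contributes its vertices, each corner two darts). [folklore] -/
theorem period_box {c : ℕ} (hc : c ≤ W) :
    period V ((x0 + c, y0), 3) = 2 * W + 2 * H + 4 := by
  have hP : 2 * W + 2 * H + 4 < 4 * V.card + 1 := by rw [card_box hV]; nlinarith
  have hlt : ∀ j, j < 2 * W + 2 * H + 4 →
      j = 0 ∨ ¬ (dsucc V)^[j] ((x0 + ↑c, y0), 3) = ((x0 + ↑c, y0), 3) := fun j hj => by
    rcases Nat.eq_zero_or_pos j with h0 | h0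
    · exact Or.inl h0
    · exact Or.inr (tour_ne hV hc h0 hj)
  have hfind : (List.range (4 * V.card + 1)).find?
      (fun n => decide (0 < n ∧ (dsucc V)^[n] ((x0 + ↑c, y0), 3) = ((x0 + ↑c, y0), 3))) =
      some (2 * W + 2 * H + 4) := by
    rw [List.find?_eq_some_iff_getElem]
    refine ⟨?_, 2 * W + 2 * H + 4, by simpa using hP, by simp, fun j hj => ?_⟩
    · rw [decide_eq_true_eq]; exact ⟨by omega, tour_period hV hc⟩
    · simpa [List.getElem_range] using hlt j hj
  rw [period, hfind]; rfl

/-- **The boundary cycle of the box** through a bottom dart: the `2W + 2H + 4` iterates of `dsucc`. [folklore] -/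
theorem cycle_box {c : ℕ} (hc : c ≤ W) :
    cycle V ((x0 + c, y0), 3) = List.iterate (dsucc V) ((x0 + c, y0), 3) (2 * W + 2 * H + 4) := by
  rw [cycle, period_box hV hc]

/-- Length of the boundary cycle of the box. [folklore] -/
theorem length_cycle_box {c : ℕ} (hc : c ≤ W) :
    (cycle V ((x0 + c, y0), 3)).length = 2 * W + 2 * H + 4 := by
  rw [cycle_box hV hc, List.length_iterate]

/-- The darts of the boundary cycle of the box are pairwise distinct. [folklore] -/
theorem nodup_cycle_box {c : ℕ} (hc : c ≤ W) :
    (cycle V ((x0 + c, y0), 3)).Nodup := by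
  rw [cycle_box hV hc, List.nodup_iff_injective_getElem]
  have aux : ∀ i j : ℕ, i < j → j < 2 * W + 2 * H + 4 →
      (dsucc V)^[i] ((x0 + ↑c, y0), 3) = (dsucc V)^[j] ((x0 + ↑c, y0), 3) → False := by
    intro i j hlt hj hij
    have key : (dsucc V)^[2 * W + 2 * H + 4 - j + i] ((x0 + ↑c, y0), 3) = ((x0 + ↑c, y0), 3) := by
      rw [Function.iterate_add_apply, hij, ← Function.iterate_add_apply, Nat.sub_add_cancel hj.le,
        tour_period hV hc]
    exact tour_ne hV hc (by omega) (by omega) key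
  intro ⟨i, hi⟩ ⟨j, hj⟩ hij
  simp only [List.getElem_iterate, List.length_iterate] at hij hi hj
  simp only [Fin.mk.injEq]
  rcases lt_trichotomy i j with h | h | h
  · exact (aux i j h hj hij).elim
  · exact h
  · exact (aux j i h hi hij.symm).elim

/-! ### The exterior dart of a bottom-row vertex -/

/-- A non-corner bottom-row vertex `(m, y0)` of a box of positive height has exactly one exterior
dart, its `S`-dart: `outDart V (m, y0) = some ((m, y0), S)`. [folklore] -/
theorem outDart_bottom (hH : 0 < H) {m : ℤ} (hm0 : x0 < m) (hm : m < x0 + W) :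
    outDart V (m, y0) = some ((m, y0), 3) := by
  have h0 : ((m + 1, y0) : ℤ × ℤ) ∈ V := by rw [hV]; simp; omega
  have h1 : ((m, y0 + 1) : ℤ × ℤ) ∈ V := by rw [hV]; simp; omega
  have h2 : ((m + -1, y0) : ℤ × ℤ) ∈ V := by rw [hV]; simp; omega
  have h3 : ((m, y0 + -1) : ℤ × ℤ) ∉ V := by rw [hV]; simp
  rw [outDart, finRange_four]
  simp [h0, h1, h2, h3]

/-- A non-corner bottom-row vertex of a box of positive height has exactly one lattice neighbour
outside the box (the one below it). [folklore] -/
theorem card_neighbours_filter_bottom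
   
    (hH : 0 < H) {m : ℤ} (hm0 : x0 < m) (hm : m < x0 + W) :
    ((neighbours (m, y0)).filter fun y => y ∉ V).card = 1 := by
  have h0 : ((m + 1, y0) : ℤ × ℤ) ∈ V := by rw [hV]; simp; omega
  have h1 : ((m, y0 + 1) : ℤ × ℤ) ∈ V := by rw [hV]; simp; omega
  have h2 : ((m - 1, y0) : ℤ × ℤ) ∈ V := by rw [hV]; simp; omega
  have h3 : ((m, y0 - 1) : ℤ × ℤ) ∉ V := by rw [hV]; simp
  have : (neighbours (m, y0)).filter (fun y => y ∉ V) = {(m, y0 - 1)} := by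
    ext v
    simp only [neighbours, Finset.mem_filter, Finset.mem_insert, Finset.mem_singleton]
    constructor
    · rintro ⟨h | h | h | h, hv⟩ <;> subst h
      · exact (hv h0).elim
      · exact (hv h1).elim
      · exact (hv h2).elim
      · rfl
    · rintro rfl; exact ⟨Or.inr (Or.inr (Or.inr rfl)), h3⟩
  rw [this, Finset.card_singleton]

/-- Every non-corner bottom-row vertex lies in the box. [folklore] -/
theorem bottom_mem_box {m : ℤ} (hm0 : x0 ≤ m) (hm : m ≤ x0 + W) : ((m, y0) : ℤ × ℤ) ∈ V := by
  rw [hV]; simp; omega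

end Box

/-- **Sub-goal `s4_boxBoundaryCycle` of stub 4** (registered on stmt-CriticalPhenomena-14132): the
boundary walk of the lattice box `[x0, x0 + W] × [y0, y0 + H]` from a bottom dart `((x0 + c, y0), S)`
has first-return time `2W + 2H + 4`, so its `cycle` is the list of these `2W + 2H + 4` iterates of
`dsucc`, which are pairwise distinct (`period_box`, `cycle_box`, `nodup_cycle_box`). [folklore] -/
theorem s4_boxBoundaryCycle : ∀ (V : Finset (ℤ × ℤ)) (x0 y0 : ℤ) (W H c : ℕ), (∀ v : ℤ × ℤ, v ∈ V ↔ (x0 ≤ v.1 ∧ v.1 ≤ x0 + W) ∧ (y0 ≤ v.2 ∧ v.2 ≤ y0 + H)) → c ≤ W → Literature.Probability.LatticeModels.CollarLegModel.period V ((x0 + c, y0), 3) = 2 * W + 2 * H + 4 ∧ Literature.Probability.LatticeModels.CollarLegModel.cycle V ((x0 + c, y0), 3) = List.iterate (Literature.Probability.LatticeModels.CollarLegModel.dsucc V) ((x0 + c, y0), 3) (2 * W + 2 * H + 4) ∧ (Literature.Probability.LatticeModels.CollarLegModel.cycle V ((x0 + c, y0), 3)).Nodup :=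
  fun _ _ _ _ _ _ hV hc => ⟨period_box hV hc, cycle_box hV hc, nodup_cycle_box hV hc⟩


end Summit.CriticalPhenomena.CardyFormulaZ2.Cruxes.BoundaryDefectGaussianR.RainbowMonomialsInExcursionKernels
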